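import Literature.AlgebraicGeometry.Frobenioids.PerfFactorialSupports
import HarnessLib

/-!
# Frobenioids I, Definition 2.4 (i)(d): the support of an element of a perf-factorial monoid, prime by prime —
# "`𝔭 ∈ Supp(a)` iff a primary element of `𝔭` divides a power of `a`" — PROOF

Mochizuki, *The geometry of Frobenioids I: the general theory*, Kyushu J. Math. **62** (2008) 293–400, Def. 2.4
(i), kurims text p. 47 (perf-factorial monoids, the factorization homomorphism `M^pf → M^rlf_factor`, "(d) … the
support `Supp(a) ⊆ Prime(M)`"), §0 p. 12 (`≼`, primary elements, primes). [cite: MochizukiFrdI2008, Def. 2.4 (i) p.47]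

PROOF-ONLY (seat abc-iut-L6-t10 gen 2, S3 sub-DAG holder). The rational-type theorems of the §6 sub-DAG
(`isStrictlyRational_arith` / `_geom` / `PadicFrd.Datum.isStrictlyRational`, landed p413493 / p413501 / p413887) are
stated for ANY support predicate `Supp a 𝔭` satisfying the SUPPORT AXIOM "`Supp a 𝔭 ↔` some primary element of the class
`𝔭` is `≼ a`". This file proves that THE support of Def. 2.4 (i)(d) — `𝔮 ∈ supp (factorMap M x)` for `x ∈ M^pf`, over
abc-iut-L1-t14/L1-d2's perf-factorial API — satisfies exactly that axiom:
* `IsPerfFactorial.mem_supp_factorMap_iff_exists_dvd` — for `x ∈ M^pf`: `𝔮 ∈ Supp(x)` iff some element of `𝔮`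
  divides `x` (the `𝔮`-component / `𝔮`-free splitting `exists_split`);
* `IsPerfFactorial.supp_factorMap_pow` — `Supp(x^n) = Supp(x)` for `n ≥ 1`;
* `IsPerfFactorial.precsim_iff_mem_supp_factorMap_of` — for `a ∈ M` and a primary `a₁ ∈ M`:
  `a₁ ≼ a ↔ [a₁^{pf}] ∈ Supp(a^{pf})` (the prime of `M^pf` through the image of `a₁`; `Prime(M) ⥲ Prime(M^pf)`,
  §0 p. 12), i.e. the support axiom for THE support, prime by prime.
No definitions; nothing here bears on [IUTchIII] or asserts anything about abc.
-/

namespace Literature.AlgebraicGeometry.Frobenioids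

open Function

universe u

variable {M : Type u} [CommMonoid M]

/-- **`𝔮 ∈ Supp(x)` iff some element of the prime `𝔮` divides `x`** (`x ∈ M^pf`, `M` perf-factorial): split
`x = x₁ · x₂` into its `𝔮`-component and its `𝔮`-free part (Def. 2.4 (i)(c)(d)); the `𝔮`-coordinate of `x` is
nonzero iff `x₁ ≠ 1`, and then `x₁ ∈ 𝔮` divides `x`; conversely `Supp` is monotone for divisibility and an element of
`𝔮` has nonzero `𝔮`-coordinate. [cite: MochizukiFrdI2008, Def. 2.4 (i) p.47] -/
theorem IsPerfFactorial.mem_supp_factorMap_iff_exists_dvd (h : IsPerfFactorial M) (x : Perfection M)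
    (𝔮 : Primes (Perfection M)) : 𝔮 ∈ supp (factorMap M x) ↔ ∃ q ∈ 𝔮.carrier, q ∣ x := by
  classical
  constructor
  · intro hx
    obtain ⟨x₁, x₂, c₁, hx12, hx₁, hx₂⟩ := h.exists_split x 𝔮
    have hx₁1 : x₁ ≠ 1 := by
      intro h1
      rw [h1, one_mul] at hx12
      rw [← hx12] at hx
      exact hx hx₂
    exact ⟨x₁, h.mem_carrier_of_factorMap_eq_mulSingle c₁ hx₁ hx₁1, ⟨x₂, hx12.symm⟩⟩
  · rintro ⟨q, hq, hqx⟩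
    exact h.supp_factorMap_subset_of_dvd hqx (h.factorMap_apply_ne_one hq)

/-- `Supp(x^n) = Supp(x)` for `n ≥ 1` (coordinates live in the torsion-free monoids `M^rlf_𝔮`).
[cite: MochizukiFrdI2008, Def. 2.4 (i) p.47] -/
theorem IsPerfFactorial.supp_factorMap_pow (h : IsPerfFactorial M) (x : Perfection M) {n : ℕ} (hn : 0 < n) :
    supp (factorMap M (x ^ n)) = supp (factorMap M x) := by
  ext 𝔮
  rw [← h.factorHom_apply, map_pow, h.factorHom_apply]
  simp only [supp, Set.mem_setOf_eq, Pi.pow_apply, ne_eq]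
  constructor
  · intro hne h1
    exact hne (by rw [h1, one_pow])
  · intro hne h1
    exact hne ((isSharp_realification _).isTorsionFree.1 _ n hn h1)

/-- **The support axiom for THE support, prime by prime**: for `M` perf-factorial, `a ∈ M` and a primary `a₁ ∈ M`,
`a₁ ≼ a` (i.e. `a₁ ∣ a^n` for some `n ≥ 1`) iff the prime of `M^pf` through the image of `a₁` lies in the support of
the image of `a` (Def. 2.4 (i)(d); `Prime(M) ⥲ Prime(M^pf)`, §0 p. 12). [cite: MochizukiFrdI2008, Def. 2.4 (i) p.47] -/
theorem IsPerfFactorial.precsim_iff_mem_supp_factorMap_of (h : IsPerfFactorial M) (a : M) {a₁ : M}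
    (h₁ : IsPrimary a₁) :
    Precsim a₁ a ↔
      Quotient.mk (primarySetoid _)
          ⟨Perfection.of M a₁, (Perfection.isPrimary_of_iff h.isDivisorial.isSharp).mpr h₁⟩ ∈
        supp (factorMap M (Perfection.of M a)) := by
  have h₁' : IsPrimary (Perfection.of M a₁) := (Perfection.isPrimary_of_iff h.isDivisorial.isSharp).mpr h₁
  let 𝔮 : Primes (Perfection M) := Quotient.mk (primarySetoid _) ⟨Perfection.of M a₁, h₁'⟩
  have hmem : Perfection.of M a₁ ∈ 𝔮.carrier := ⟨h₁', rfl⟩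
  change Precsim a₁ a ↔ 𝔮 ∈ supp (factorMap M (Perfection.of M a))
  constructor
  · rintro ⟨n, hn, hdvd⟩
    rw [← h.supp_factorMap_pow _ hn, ← map_pow]
    exact h.supp_factorMap_subset_of_dvd (map_dvd (Perfection.of M) hdvd) (h.factorMap_apply_ne_one hmem)
  · intro hsupp
    obtain ⟨q, hq, hqa⟩ := (h.mem_supp_factorMap_iff_exists_dvd _ _).mp hsupp
    -- `of a₁ ≼ q` (same prime) and `q ∣ of a`, so `of a₁ ≼ of a`, i.e. `a₁ ≼ a`
    obtain ⟨hq', hqcls⟩ := hq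
    have hq1 : Precsim q (Perfection.of M a₁) := Quotient.exact hqcls
    have h1q : Precsim (Perfection.of M a₁) q := h₁'.2 q hq'.1 hq1
    exact Perfection.of_precsim_of_iff.mp (h1q.trans (Precsim.of_dvd hqa))

end Literature.AlgebraicGeometry.Frobenioids
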